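import Summits.ABC.ABC.Theorems.SparseGoodScales.Negative.EveryScale

/-!
# `SparseGoodScales` (stmt-ABC-2161): an EXPLICIT threshold for the `δ = 0` tightness —
# every scale `R ≥ 2^30 · 3^110` is bad at exponent `1`

Negative support lemma for the crux `Summit.ABC.ABC.Theses.FeketeScales.SparseGoodScales`
(lead seat c5).  `Negative/EveryScale.lean` proves `liminf_R G(R)/R = +∞` with a threshold `N(K)` that
is astronomically large already for `K = 1` (its Dirichlet step is ineffective in practice:
instantiated by the convergent `84/53` it gives `N ≈ (2^{13104})^{2.7·10^4}`).  This file gives the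
`K = 1` statement with the explicit threshold `X₀ = 2^30 · 3^110 ≈ 3.27 · 10^61`:

  `exists_triple_straddle_of_ge_pow : 2^30 * 3^110 ≤ R → ∃ abc triple, rad ≤ R ∧ R < c`.

Mechanism (a LATTICE WALK instead of a geometric chain).  In the rank-two lattice
`L = {(x, y) ∈ ℤ² : 2^x 3^y ≡ 1 (mod 5³)}` (index `100`) the two vectors `u = (59, −37)` and
`w = (−144, 92)` (a basis of `L`) have values `59 log 2 − 37 log 3 ≈ 0.247` and
`92 log 3 − 144 log 2 ≈ 1.259`, both in `(0, log (25/6))`.  A point `(x, y) ∈ L ∩ ℕ²` of value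
`x log 2 + y log 3 ≥ T₀ := 144 log 2 + 37 log 3` has `y ≥ 37` or `x ≥ 144`, so `u` or `w` applies and
raises the value by at most `1.2592`; a maximal-element argument (`walk`) then puts a lattice point in
every window `(t, t + 1.2592]`, `t ≥ v(q)`, where `q = (30, 110) ∈ L` is a point of value `≥ T₀`.  For
`R ≥ 2^30 3^110` this yields `c = 2^x 3^y ∈ (R, (3^92/2^144) R]` with `125 ∣ c − 1`, and the triple
`(1, c − 1, c)` has `rad ≤ 6 · rad(c − 1) ≤ 6 (c − 1)/25 < (6 · 3^92 / (25 · 2^144)) R < R`.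

Below `X₀` the scales `30 ≤ R < 7^{12}` are certified bad in `Negative/SmallScales.lean`; the gap
`[7^{12}, X₀)` is closed by an explicit covering certificate in `Negative/CoverChain.lean`.
-/

noncomputable section

namespace Summit.ABC.ABC.Theorems.SparseGoodScales.Negative

open Literature.NumberTheory.DiophantineGeometry UniqueFactorizationMonoid

/-! ## Radical bound from a prime-power divisor -/

/-- If `m^(k+1) ∣ b` with `b > 0` then `radical b · m^k ≤ b` (any `m`). [folklore] -/
theorem radical_mul_pow_le_of_pow_succ_dvd {m b k : ℕ} (hb : 0 < b) (hmb : m ^ (k + 1) ∣ b) :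
    radical b * m ^ k ≤ b := by
  obtain ⟨t, ht⟩ := hmb
  have h1 : radical b ∣ m * t := by
    rw [ht]
    calc radical (m ^ (k + 1) * t) ∣ radical (m ^ (k + 1)) * radical t := radical_mul_dvd
      _ = radical m * radical t := by rw [radical_pow _ (Nat.succ_ne_zero k)]
      _ ∣ m * t := mul_dvd_mul radical_dvd_self radical_dvd_self
  have hmt : 0 < m * t := by
    rcases Nat.eq_zero_or_pos (m * t) with h | h
    · exfalso
      have : b = m ^ k * (m * t) := by rw [ht]; ring
      rw [this, h, mul_zero] at hb
      exact lt_irrefl 0 hb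
    · exact h
  calc radical b * m ^ k ≤ m * t * m ^ k := Nat.mul_le_mul_right _ (Nat.le_of_dvd hmt h1)
    _ = b := by rw [ht]; ring

/-! ## The abstract lattice walk -/

/-- **Lattice walk.**  Let `good ⊆ ℕ²` be closed under the steps `(x, y) ↦ (x + a, y − b)` (when
`y ≥ b`) and `(x, y) ↦ (x − c, y + d)` (when `x ≥ c`), whose values `aα − bβ`, `dβ − cα` lie in
`(0, ε]` (`α, β > 0`).  If some good point `q` has value `v(q) ≥ cα + bβ`, then every `t ≥ v(q)` has a
good point of value in `(t, t + ε]`.  (Proof: a good point of maximal value in `[cα + bβ, t]` can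
always step.) [folklore] -/
theorem walk {good : ℕ → ℕ → Prop} {α β ε : ℝ} (hα : 0 < α) (hβ : 0 < β) {a b c d : ℕ}
    (hu : ∀ x y, good x y → b ≤ y → good (x + a) (y - b))
    (hw : ∀ x y, good x y → c ≤ x → good (x - c) (y + d))
    (hu₁ : 0 < a * α - b * β) (hu₂ : a * α - b * β ≤ ε)
    (hw₁ : 0 < d * β - c * α) (hw₂ : d * β - c * α ≤ ε)
    {x₀ y₀ : ℕ} (hq : good x₀ y₀) (hq₀ : c * α + b * β ≤ x₀ * α + y₀ * β)
    {t : ℝ} (ht : x₀ * α + y₀ * β ≤ t) :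
    ∃ x y : ℕ, good x y ∧ t < x * α + y * β ∧ x * α + y * β ≤ t + ε := by
  classical
  have ht0 : 0 ≤ t := le_trans (by positivity) ht
  -- the finite set of good points with value in `[cα + bβ, t]`
  set v : ℕ × ℕ → ℝ := fun p => p.1 * α + p.2 * β with hv
  set S : Finset (ℕ × ℕ) :=
    ((Finset.range (⌊t / α⌋₊ + 1)) ×ˢ (Finset.range (⌊t / β⌋₊ + 1))).filter
      (fun p => good p.1 p.2 ∧ c * α + b * β ≤ v p ∧ v p ≤ t) with hS
  -- membership criterion
  have hmem : ∀ x y : ℕ, good x y → c * α + b * β ≤ x * α + y * β → x * α + y * β ≤ t →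
      (x, y) ∈ S := by
    intro x y hg h1 h2
    simp only [hS, Finset.mem_filter, Finset.mem_product, Finset.mem_range]
    refine ⟨⟨?_, ?_⟩, hg, h1, h2⟩
    · have hx : (x : ℝ) * α ≤ t := by
        have : (0 : ℝ) ≤ y * β := by positivity
        linarith
      have : (x : ℝ) ≤ t / α := by rw [le_div_iff₀ hα]; exact hx
      exact Nat.lt_succ_of_le (Nat.le_floor this)
    · have hy : (y : ℝ) * β ≤ t := by
        have : (0 : ℝ) ≤ x * α := by positivity
        linarith
      have : (y : ℝ) ≤ t / β := by rw [le_div_iff₀ hβ]; exact hy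
      exact Nat.lt_succ_of_le (Nat.le_floor this)
  have hqS : (x₀, y₀) ∈ S := hmem x₀ y₀ hq hq₀ ht
  obtain ⟨p, hpS, hpmax⟩ := S.exists_max_image v ⟨_, hqS⟩
  obtain ⟨x, y⟩ := p
  simp only [hS, Finset.mem_filter, Finset.mem_product, Finset.mem_range] at hpS
  obtain ⟨-, hg, hlow, hupp⟩ := hpS
  have hvxy : v (x, y) = x * α + y * β := rfl
  rw [hvxy] at hlow hupp
  -- either `y ≥ b` or `x ≥ c`
  by_cases hyb : b ≤ y
  · -- step u
    refine ⟨x + a, y - b, hu x y hg hyb, ?_, ?_⟩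
    · by_contra hle
      push Not at hle
      have hval : ((x + a : ℕ) : ℝ) * α + ((y - b : ℕ) : ℝ) * β = x * α + y * β + (a * α - b * β) := by
        push_cast [Nat.cast_sub hyb]; ring
      have hin : (x + a, y - b) ∈ S := hmem _ _ (hu x y hg hyb) (by rw [hval]; linarith) hle
      have := hpmax _ hin
      simp only [hv] at this
      rw [hval] at this
      linarith
    · have hval : ((x + a : ℕ) : ℝ) * α + ((y - b : ℕ) : ℝ) * β = x * α + y * β + (a * α - b * β) := by
        push_cast [Nat.cast_sub hyb]; ring
      rw [hval]; linarith
  · have hxc : c ≤ x := by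
      by_contra hlt
      push Not at hyb hlt
      have h1 : (x : ℝ) * α < c * α := by
        exact mul_lt_mul_of_pos_right (by exact_mod_cast hlt) hα
      have h2 : (y : ℝ) * β < b * β := by
        exact mul_lt_mul_of_pos_right (by exact_mod_cast hyb) hβ
      linarith
    refine ⟨x - c, y + d, hw x y hg hxc, ?_, ?_⟩
    · by_contra hle
      push Not at hle
      have hval : ((x - c : ℕ) : ℝ) * α + ((y + d : ℕ) : ℝ) * β = x * α + y * β + (d * β - c * α) := by
        push_cast [Nat.cast_sub hxc]; ring
      have hin : (x - c, y + d) ∈ S := hmem _ _ (hw x y hg hxc) (by rw [hval]; linarith) hle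
      have := hpmax _ hin
      simp only [hv] at this
      rw [hval] at this
      linarith
    · have hval : ((x - c : ℕ) : ℝ) * α + ((y + d : ℕ) : ℝ) * β = x * α + y * β + (d * β - c * α) := by
        push_cast [Nat.cast_sub hxc]; ring
      rw [hval]; linarith

/-! ## The lattice `L = {(x, y) : 2^x 3^y ≡ 1 (mod 125)}` and its two steps -/

/-- Step `u = (59, −37)`: `2^59 ≡ 3^37 (mod 125)`, so `L` is closed under `u`. [folklore] -/
theorem good125_step_u (x y : ℕ) (h : 2 ^ x * 3 ^ y ≡ 1 [MOD 125]) (hy : 37 ≤ y) :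
    2 ^ (x + 59) * 3 ^ (y - 37) ≡ 1 [MOD 125] := by
  have key : 2 ^ 59 ≡ 3 ^ 37 [MOD 125] := by decide
  -- 2^(x+59) 3^(y-37) · 3^37 ≡ 2^x 3^y · 2^59 ... compare both to 2^x 3^y 3^37-free forms
  have h1 : 2 ^ (x + 59) * 3 ^ (y - 37) ≡ 2 ^ x * 3 ^ (y - 37) * 3 ^ 37 [MOD 125] := by
    have : 2 ^ (x + 59) * 3 ^ (y - 37) = 2 ^ x * 3 ^ (y - 37) * 2 ^ 59 := by rw [pow_add]; ring
    rw [this]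
    exact Nat.ModEq.mul_left _ key
  have h2 : 2 ^ x * 3 ^ (y - 37) * 3 ^ 37 = 2 ^ x * 3 ^ y := by
    rw [mul_assoc, ← pow_add, Nat.sub_add_cancel hy]
  rw [h2] at h1
  exact h1.trans h

/-- Step `w = (−144, 92)`: `3^92 ≡ 2^144 (mod 125)`, so `L` is closed under `w`. [folklore] -/
theorem good125_step_w (x y : ℕ) (h : 2 ^ x * 3 ^ y ≡ 1 [MOD 125]) (hx : 144 ≤ x) :
    2 ^ (x - 144) * 3 ^ (y + 92) ≡ 1 [MOD 125] := by
  have key : 3 ^ 92 ≡ 2 ^ 144 [MOD 125] := by decide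
  have h1 : 2 ^ (x - 144) * 3 ^ (y + 92) ≡ 2 ^ (x - 144) * 3 ^ y * 2 ^ 144 [MOD 125] := by
    have : 2 ^ (x - 144) * 3 ^ (y + 92) = 2 ^ (x - 144) * 3 ^ y * 3 ^ 92 := by rw [pow_add]; ring
    rw [this]
    exact Nat.ModEq.mul_left _ key
  have h2 : 2 ^ (x - 144) * 3 ^ y * 2 ^ 144 = 2 ^ x * 3 ^ y := by
    rw [mul_comm (2 ^ (x - 144)) (3 ^ y), mul_assoc, ← pow_add, Nat.sub_add_cancel hx, mul_comm]
  rw [h2] at h1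
  exact h1.trans h

/-- The base point `q = (30, 110)`: `2^30 · 3^110 ≡ 1 (mod 125)`. [folklore] -/
theorem good125_base : 2 ^ 30 * 3 ^ 110 ≡ 1 [MOD 125] := by
  decide

/-! ## Numerical comparisons of powers of `2` and `3` (as real logarithms) -/

/-- `p log 2 < q log 3` from `2^p < 3^q`. [folklore] -/
private theorem log_two_three_lt {p q : ℕ} (h : 2 ^ p < 3 ^ q) :
    (p : ℝ) * Real.log 2 < q * Real.log 3 := by
  rw [← Real.log_pow, ← Real.log_pow]
  exact Real.log_lt_log (by positivity) (by exact_mod_cast h)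

/-- `q log 3 < p log 2` from `3^q < 2^p`. [folklore] -/
private theorem log_three_two_lt {p q : ℕ} (h : 3 ^ q < 2 ^ p) :
    (q : ℝ) * Real.log 3 < p * Real.log 2 := by
  rw [← Real.log_pow, ← Real.log_pow]
  exact Real.log_lt_log (by positivity) (by exact_mod_cast h)

/-- `p log 2 ≤ q log 3` from `2^p ≤ 3^q`. [folklore] -/
private theorem log_two_three_le {p q : ℕ} (h : 2 ^ p ≤ 3 ^ q) :
    (p : ℝ) * Real.log 2 ≤ q * Real.log 3 := by
  rw [← Real.log_pow, ← Real.log_pow]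
  exact Real.log_le_log (by positivity) (by exact_mod_cast h)

/-! ## Every scale `R ≥ 2^30 · 3^110` is bad at exponent `1` -/

/-- **Lattice points of `L` in every window `(t, t + (92 log 3 − 144 log 2)]` beyond `v(q)`.**
[folklore] -/
theorem exists_good125_mem_window {t : ℝ}
    (ht : (30 : ℕ) * Real.log 2 + (110 : ℕ) * Real.log 3 ≤ t) :
    ∃ x y : ℕ, 2 ^ x * 3 ^ y ≡ 1 [MOD 125] ∧ t < x * Real.log 2 + y * Real.log 3 ∧
      x * Real.log 2 + y * Real.log 3 ≤ t + ((92 : ℕ) * Real.log 3 - (144 : ℕ) * Real.log 2) := by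
  have hα : (0 : ℝ) < Real.log 2 := Real.log_pos (by norm_num)
  have hβ : (0 : ℝ) < Real.log 3 := Real.log_pos (by norm_num)
  refine walk (good := fun x y => 2 ^ x * 3 ^ y ≡ 1 [MOD 125]) hα hβ (a := 59) (b := 37) (c := 144) (d := 92)
    good125_step_u good125_step_w ?_ ?_ ?_ le_rfl good125_base ?_ ht
  · -- 3^37 < 2^59
    have := log_three_two_lt (p := 59) (q := 37) (by norm_num)
    linarith
  · -- 2^(59+144) ≤ 3^(37+92)
    have := log_two_three_le (p := 203) (q := 129) (by norm_num)
    push_cast at this ⊢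
    linarith
  · -- 2^144 < 3^92
    have := log_two_three_lt (p := 144) (q := 92) (by norm_num)
    linarith
  · -- T₀ = 144 log 2 + 37 log 3 ≤ 30 log 2 + 110 log 3, i.e. 2^114 ≤ 3^73
    have := log_two_three_le (p := 114) (q := 73) (by norm_num)
    push_cast at this ⊢
    linarith

/-- **Explicit `δ = 0` tail.**  Every scale `R ≥ 2^30 · 3^110` (`≈ 3.27 · 10^61`) admits an abc
triple with `rad(abc) ≤ R < c`, namely `(1, c − 1, c)` with `c = 2^x 3^y ≡ 1 (mod 125)` in
`(R, 3.53 R]`. [folklore] -/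
theorem exists_triple_straddle_of_ge_pow {R : ℕ} (hR : 2 ^ 30 * 3 ^ 110 ≤ R) :
    ∃ a b c : ℕ, IsABCTriple a b c ∧ rad a b c ≤ R ∧ R < c := by
  have hα : (0 : ℝ) < Real.log 2 := Real.log_pos (by norm_num)
  have hβ : (0 : ℝ) < Real.log 3 := Real.log_pos (by norm_num)
  have hR0 : (0 : ℝ) < R := by
    have : 0 < 2 ^ 30 * 3 ^ 110 := by positivity
    exact_mod_cast lt_of_lt_of_le this hR
  -- the window above `t = log R`
  have ht : (30 : ℕ) * Real.log 2 + (110 : ℕ) * Real.log 3 ≤ Real.log R := by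
    have : ((2 ^ 30 * 3 ^ 110 : ℕ) : ℝ) ≤ R := by exact_mod_cast hR
    have h := Real.log_le_log (by positivity) this
    rw [Nat.cast_mul, Nat.cast_pow, Nat.cast_pow, Real.log_mul (by positivity) (by positivity),
      Real.log_pow, Real.log_pow] at h
    exact_mod_cast h
  obtain ⟨x, y, hgood, hlow, hupp⟩ := exists_good125_mem_window ht
  set c : ℕ := 2 ^ x * 3 ^ y with hc
  have hc_pos : (0 : ℝ) < c := by rw [hc]; positivity
  have hlogc : Real.log c = x * Real.log 2 + y * Real.log 3 := by
    rw [hc, Nat.cast_mul, Nat.cast_pow, Nat.cast_pow, Real.log_mul (by positivity) (by positivity),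
      Real.log_pow, Real.log_pow]
    push_cast; ring
  -- R < c
  have hRc : R < c := by
    have : Real.log R < Real.log c := by rw [hlogc]; exact hlow
    exact_mod_cast (Real.log_lt_log_iff hR0 hc_pos).mp this
  -- c ≤ R · 3^92 / 2^144, i.e. c · 2^144 ≤ R · 3^92
  have hcup : (c : ℝ) * 2 ^ 144 ≤ R * 3 ^ 92 := by
    have h1 : Real.log ((c : ℝ) * 2 ^ 144) ≤ Real.log ((R : ℝ) * 3 ^ 92) := by
      rw [Real.log_mul hc_pos.ne' (by positivity), Real.log_mul hR0.ne' (by positivity),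
        Real.log_pow, Real.log_pow, hlogc]
      push_cast at hupp ⊢
      linarith
    exact (Real.log_le_log_iff (by positivity) (by positivity)).mp h1
  -- the witness triple
  have hc2 : 2 ≤ c := by
    have : 1 ≤ R := by exact_mod_cast hR0
    omega
  have hmod : 125 ∣ c - 1 := (Nat.modEq_iff_dvd' (by omega)).mp hgood.symm
  have h125 : 5 ^ (2 + 1) ∣ c - 1 := by norm_num; exact hmod
  have hrad1 : radical (c - 1) * 5 ^ 2 ≤ c - 1 :=
    radical_mul_pow_le_of_pow_succ_dvd (by omega) h125
  have hrc : radical c ∣ 6 := radical_pow_mul_pow_dvd 2 3 x y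
  have htriple : IsABCTriple 1 (c - 1) c := ⟨one_pos, by omega, by omega, Nat.coprime_one_left _⟩
  have hrad2 : rad 1 (c - 1) c ≤ radical (c - 1) * 6 := by
    have h1 : rad 1 (c - 1) c ∣ radical (c - 1) * 6 := by
      rw [rad_def, one_mul]
      exact radical_mul_dvd.trans (mul_dvd_mul_left _ hrc)
    exact Nat.le_of_dvd (Nat.mul_pos (Nat.radical_pos _) (by norm_num)) h1
  refine ⟨1, c - 1, c, htriple, ?_, hRc⟩
  -- 25 · rad ≤ 6 (c - 1) < 6 c ≤ 6 R 3^92 / 2^144 ≤ 25 R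
  have hnat : rad 1 (c - 1) c * 25 ≤ 6 * (c - 1) := by
    calc rad 1 (c - 1) c * 25 ≤ radical (c - 1) * 6 * 25 := Nat.mul_le_mul_right 25 hrad2
      _ = radical (c - 1) * 5 ^ 2 * 6 := by ring
      _ ≤ (c - 1) * 6 := Nat.mul_le_mul_right 6 hrad1
      _ = 6 * (c - 1) := by ring
  have hreal : ((rad 1 (c - 1) c : ℕ) : ℝ) * 25 < 25 * R := by
    have h1 : ((rad 1 (c - 1) c : ℕ) : ℝ) * 25 ≤ 6 * ((c : ℝ) - 1) := by
      have : ((rad 1 (c - 1) c * 25 : ℕ) : ℝ) ≤ ((6 * (c - 1) : ℕ) : ℝ) := by exact_mod_cast hnat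
      push_cast [Nat.cast_sub (by omega : 1 ≤ c)] at this
      linarith
    -- 6 · 3^92 ≤ 25 · 2^144
    have h2 : (6 : ℝ) * 3 ^ 92 ≤ 25 * 2 ^ 144 := by norm_num
    nlinarith [hcup, hR0]
  have : ((rad 1 (c - 1) c : ℕ) : ℝ) < R := by linarith
  exact_mod_cast this.le

end Summit.ABC.ABC.Theorems.SparseGoodScales.Negative
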